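import Literature.Probability.RandomPlanarGeometry.HexParafermion

/-!
# Restricting the domain: monotonicity and inclusion–exclusion of exit masses

Helper file for the crux `NoFoldBound` (stmt-CriticalPhenomena-8296) of the route `SAWDevelopingMap`
(sub-problem `SAWScalingLimit` of `CriticalPhenomena`), programme FLAT / PEELED LP of the lead seats
c9–c10 (`FLAT-FINITE.md`, `FLAT-LEAN-DESIGN.md` on the item), brick L1(I). The unknowns of the peeled
linear programme are exit masses `g(D, a, z) = Σ_{γ ⊂ D : a → z} x^{ℓ(γ)}` of nested domains
`D ⊇ D ∖ {t₁} ⊇ D ∖ {t₁, t₂}`; its inequality rows are the positivity of inclusion–exclusion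
combinations. Everything rests on one bookkeeping identity: the walks of a sub-domain `D' ⊆ D`
(keeping the entrance vertex) are exactly the walks of `D` that stay in `D'` (`sum_pow_length_restrict`).
Consequences: monotonicity in the domain (`sum_pow_length_mono`, the comparison behind
"`Z_Λ ≤ Z_{Λ'}` for `Λ ⊆ Λ'`" used to reduce flat configurations to strips), the one-point
difference `g(D) − g(D ∖ t) = Σ_{γ ∋ t} x^ℓ ≥ 0` and the two-point inequality
`g(D) − g(D ∖ t₁) − g(D ∖ t₂) + g(D ∖ t₁ ∖ t₂) = Σ_{γ ∋ t₁, t₂} x^ℓ ≥ 0` (`sum_pow_length_incl_excl_two`).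
Walks between mid-edges are Duminil-Copin–Smirnov's (`HexMidEdgeSAW`, `HexParafermion.lean`).

## Contents (namespace `Summit.CriticalPhenomena.SAWScalingLimit.Theorems.SAWDevelopingMapNoFoldBound.Peel`)
* `exists_extend`, `exists_restrict` — a walk of `D'` is a walk of `D`; a walk of `D` inside `D'` is a walk of `D'`;
* **`sum_pow_length_restrict`** — `Σ_{D'} x^ℓ = Σ_{D} [γ ⊂ D'] x^ℓ`;
* `sum_pow_length_mono`, `sum_pow_length_erase`, `sum_pow_length_sub_erase_nonneg`,
  **`sum_pow_length_incl_excl_two`**.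
-/

noncomputable section

open scoped BigOperators Classical
open Literature.Probability.LatticeModels Literature.Probability.RandomPlanarGeometry.SAW

namespace Summit.CriticalPhenomena.SAWScalingLimit.Theorems.SAWDevelopingMapNoFoldBound.Peel

variable {D D' : Finset HexVertex} {a z : Sym2 HexVertex}

/-! ### Extending and restricting walks -/

/-- A walk of a sub-domain `D' ⊆ D` is a walk of `D` (same vertex list). -/
theorem exists_extend (h : D' ⊆ D) (δ : HexMidEdgeSAW D' a z) :
    ∃ γ : HexMidEdgeSAW D a z, γ.verts = δ.verts := by
  obtain ⟨he, v, hv, hvD⟩ := δ.fst_mem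
  exact ⟨⟨δ.verts, fun w hw => h (δ.subset w hw), δ.nodup, δ.isChain, δ.head_mem, δ.getLast_mem,
    δ.eq_of_nil, δ.edges_nodup, ⟨he, v, hv, h hvD⟩⟩, rfl⟩

/-- A walk of `D` all of whose vertices lie in `D'`, where `D'` keeps the endpoints of the entrance
mid-edge that are in `D`, is a walk of `D'`. -/
theorem exists_restrict (ha : ∀ v ∈ a, v ∈ D → v ∈ D') (γ : HexMidEdgeSAW D a z)
    (hγ : ∀ v ∈ γ.verts, v ∈ D') : ∃ δ : HexMidEdgeSAW D' a z, δ.verts = γ.verts := by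
  obtain ⟨he, v, hv, hvD⟩ := γ.fst_mem
  exact ⟨⟨γ.verts, hγ, γ.nodup, γ.isChain, γ.head_mem, γ.getLast_mem, γ.eq_of_nil, γ.edges_nodup,
    ⟨he, v, hv, ha v hv hvD⟩⟩, rfl⟩

/-! ### The restriction identity -/

/-- **Restriction.** For `D' ⊆ D` keeping the entrance (`∀ v ∈ a, v ∈ D → v ∈ D'`), the mass of the
walks of `D'` is the mass of the walks of `D` that stay inside `D'`. -/
theorem sum_pow_length_restrict : ∀ {D D' : Finset HexVertex} {a z : Sym2 HexVertex}, D' ⊆ D → (∀ v ∈ a, v ∈ D → v ∈ D') → ∀ x : ℝ, (∑ δ : HexMidEdgeSAW D' a z, x ^ δ.length) = ∑ γ : HexMidEdgeSAW D a z, if (∀ v ∈ γ.verts, v ∈ D') then x ^ γ.length else 0 := by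
  intro D D' a z h ha x
  classical
  rw [← Finset.sum_filter]
  refine Finset.sum_bij' (fun δ _ => (exists_extend h δ).choose)
    (fun γ hγ => (exists_restrict ha γ (Finset.mem_filter.1 hγ).2).choose) (fun δ _ => ?_)
    (fun _ _ => Finset.mem_univ _) (fun δ _ => ?_) (fun γ hγ => ?_) (fun δ _ => ?_)
  · have h1 := (exists_extend h δ).choose_spec
    refine Finset.mem_filter.2 ⟨Finset.mem_univ _, ?_⟩
    rw [h1]; exact δ.subset
  · have h1 := (exists_extend h δ).choose_spec
    have key : ∀ hγ : ∀ v ∈ (exists_extend h δ).choose.verts, v ∈ D',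
        (exists_restrict ha (exists_extend h δ).choose hγ).choose.verts = (exists_extend h δ).choose.verts :=
      fun hγ => (exists_restrict ha _ hγ).choose_spec
    apply HexMidEdgeSAW.ext
    rw [key, h1]
    rw [h1]; exact δ.subset
  · have h2 := (exists_restrict ha γ (Finset.mem_filter.1 hγ).2).choose_spec
    have h1 := (exists_extend h (exists_restrict ha γ (Finset.mem_filter.1 hγ).2).choose).choose_spec
    apply HexMidEdgeSAW.ext
    rw [h1, h2]
  · have h1 := (exists_extend h δ).choose_spec
    rw [HexMidEdgeSAW.length, HexMidEdgeSAW.length, h1]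

/-- **Monotonicity in the domain** (`x ≥ 0`): enlarging the domain (keeping the entrance) only adds
walks. In particular the returning-loop series of `SourceLoopBound` is monotone in `Λ`. -/
theorem sum_pow_length_mono : ∀ {D D' : Finset HexVertex} {a z : Sym2 HexVertex}, D' ⊆ D → (∀ v ∈ a, v ∈ D → v ∈ D') → ∀ x : ℝ, 0 ≤ x → (∑ δ : HexMidEdgeSAW D' a z, x ^ δ.length) ≤ ∑ γ : HexMidEdgeSAW D a z, x ^ γ.length := by
  intro D D' a z h ha x hx
  rw [sum_pow_length_restrict h ha x]
  refine Finset.sum_le_sum fun γ _ => ?_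
  split_ifs
  · exact le_rfl
  · exact pow_nonneg hx _

/-- Erasing a vertex `t ∉ a`: the walks of `D ∖ {t}` are the walks of `D` avoiding `t`. -/
theorem sum_pow_length_erase {t : HexVertex} (ht : t ∉ a) (x : ℝ) :
    (∑ δ : HexMidEdgeSAW (D.erase t) a z, x ^ δ.length) =
      ∑ γ : HexMidEdgeSAW D a z, if t ∉ γ.verts then x ^ γ.length else 0 := by
  rw [sum_pow_length_restrict (D.erase_subset t) (fun v hv hvD => Finset.mem_erase.2
    ⟨fun h => ht (h ▸ hv), hvD⟩) x]
  refine Finset.sum_congr rfl fun γ _ => ?_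
  have : (∀ v ∈ γ.verts, v ∈ D.erase t) ↔ t ∉ γ.verts := by
    constructor
    · intro h htm; exact (Finset.mem_erase.1 (h t htm)).1 rfl
    · intro h v hv; exact Finset.mem_erase.2 ⟨fun e => h (e ▸ hv), γ.subset v hv⟩
  rw [if_congr this rfl rfl]

/-- **One-point inclusion–exclusion**: `g(D) − g(D ∖ t)` is the mass of the walks through `t`, `≥ 0`. -/
theorem sum_pow_length_sub_erase_nonneg : ∀ {D : Finset HexVertex} {a z : Sym2 HexVertex} {t : HexVertex}, t ∉ a → ∀ x : ℝ, 0 ≤ x → 0 ≤ (∑ γ : HexMidEdgeSAW D a z, x ^ γ.length) - ∑ δ : HexMidEdgeSAW (D.erase t) a z, x ^ δ.length := by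
  intro D a z t ht x hx
  rw [sum_pow_length_erase ht, ← Finset.sum_sub_distrib]
  refine Finset.sum_nonneg fun γ _ => ?_
  have hp : 0 ≤ x ^ γ.length := pow_nonneg hx _
  split_ifs <;> simp [hp]

/-- **Two-point inclusion–exclusion**: for `t₁, t₂ ∉ a`,
`g(D) − g(D ∖ t₁) − g(D ∖ t₂) + g(D ∖ t₁ ∖ t₂) = Σ_{γ ∋ t₁, t₂} x^ℓ ≥ 0`
(the inequality rows `|T'| = 2` of the peeled linear programme). -/
theorem sum_pow_length_incl_excl_two : ∀ {D : Finset HexVertex} {a z : Sym2 HexVertex} {t₁ t₂ : HexVertex}, t₁ ∉ a → t₂ ∉ a → ∀ x : ℝ, 0 ≤ x → 0 ≤ (∑ γ : HexMidEdgeSAW D a z, x ^ γ.length) - (∑ δ : HexMidEdgeSAW (D.erase t₁) a z, x ^ δ.length) - (∑ δ : HexMidEdgeSAW (D.erase t₂) a z, x ^ δ.length) + ∑ δ : HexMidEdgeSAW ((D.erase t₁).erase t₂) a z, x ^ δ.length := by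
  intro D a z t₁ t₂ h₁ h₂ x hx
  -- all four masses as sums over the walks of `D`
  have e12 : (∑ δ : HexMidEdgeSAW ((D.erase t₁).erase t₂) a z, x ^ δ.length) =
      ∑ γ : HexMidEdgeSAW D a z, if t₁ ∉ γ.verts ∧ t₂ ∉ γ.verts then x ^ γ.length else 0 := by
    rw [sum_pow_length_restrict ((Finset.erase_subset t₂ _).trans (D.erase_subset t₁))
      (fun v hv hvD => Finset.mem_erase.2 ⟨fun h => h₂ (h ▸ hv),
        Finset.mem_erase.2 ⟨fun h => h₁ (h ▸ hv), hvD⟩⟩) x]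
    refine Finset.sum_congr rfl fun γ _ => ?_
    have : (∀ v ∈ γ.verts, v ∈ (D.erase t₁).erase t₂) ↔ t₁ ∉ γ.verts ∧ t₂ ∉ γ.verts := by
      constructor
      · intro h
        exact ⟨fun hm => (Finset.mem_erase.1 (Finset.mem_erase.1 (h t₁ hm)).2).1 rfl,
          fun hm => (Finset.mem_erase.1 (h t₂ hm)).1 rfl⟩
      · rintro ⟨n₁, n₂⟩ v hv
        exact Finset.mem_erase.2 ⟨fun e => n₂ (e ▸ hv),
          Finset.mem_erase.2 ⟨fun e => n₁ (e ▸ hv), γ.subset v hv⟩⟩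
    rw [if_congr this rfl rfl]
  rw [sum_pow_length_erase h₁, sum_pow_length_erase h₂, e12, ← Finset.sum_sub_distrib,
    ← Finset.sum_sub_distrib, ← Finset.sum_add_distrib]
  refine Finset.sum_nonneg fun γ _ => ?_
  have hp : 0 ≤ x ^ γ.length := pow_nonneg hx _
  by_cases n₁ : t₁ ∉ γ.verts <;> by_cases n₂ : t₂ ∉ γ.verts <;> simp [n₁, n₂, hp]

end Summit.CriticalPhenomena.SAWScalingLimit.Theorems.SAWDevelopingMapNoFoldBound.Peel
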